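import Literature.NumberTheory.Weil1964.AdelicDoublingDiagonalLift
import Literature.NumberTheory.Weil1964.AdelicMetaplecticTwistCharacter
import Literature.NumberTheory.Automorphic.UnitaryDualPairDoubledLineStabiliser
import Literature.NumberTheory.Automorphic.UnitaryGroupDirectSumCarriers
import Literature.NumberTheory.Automorphic.UnitaryGroupDoubledSiegelBruhat
import HarnessLib

/-!
# The plain `V`-diagonal doubling lift IS the `V`-member of the DOUBLED dual pair; it commutes with the rational points of
# the doubled `W`-member — in `Sp□(𝔸)` always, and ON THE NOSE in `Mp_ψ(𝕎□_𝔸)ᶜᵒⁿᵗ` over the rational Siegel stabiliser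

Topic `NumberTheory/Automorphic`; namespace `Literature.NumberTheory.Automorphic.UnitaryGroup` (sequel of `UnitaryDualPairDoubledLineStabiliser`,
`UnitaryGroupDirectSumCarriers`, `Weil1964/AdelicDoublingDiagonalLift`).  KERNEL only: proved theorems, no definition, no named fact, no `sorry`.
Setting (the doubling see-saw of [Kudla1984, §1], [GelbartPiatetskishapiroRallis1987, Part A §2], [Li1992, §3 p. 181]): a quadratic extension
`E/F` of number fields with conjugation `c`, `δ ∈ E` with `c δ = −δ`, a hermitian space `V` (`J_V = T_V ⊗ 1`, rank `N`) and a hermitian LINE `W`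
(`J_W = T_W ⊗ 1`), the unitary dual pair `(U(J_V), U(J_W))` inside `Sp(𝕎_𝔸)`, `𝕎 = Res_{E/F}(V ⊗ W)` (enumeration `e : Fin N × Fin 1 ≃ Fin n`,
★ `GelbartRogawski1991.UnitaryDualPair.toSp`), and the DOUBLED pair `(U(J_V), U(J_W ⊕ᶠ −J_W))` inside `Sp(𝕎□_𝔸)`, `𝕎□ = 𝕎 ⊕ 𝕎⁻`
(Gram `doubledGramFin F (adelicGram F e T_V T_W)`, doubled enumeration `eD : (i,0) ↦ inl (e(i,0)), (i,1) ↦ inr (e(i,0))`).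

* §1 `reindexW_spSumEquiv_doubled` — the reindexing combinatorics of `eD` (pure linear algebra over any commutative ring).
* §2a `doublingLift_mul_ratThetaLiftCont_of_mem_siegel` (generic, any Gram `T`): if a rational `γ ∈ Sp_{2(n+n)}(F)` has `ratSp (δγδ⁻¹) ∈ P_𝕐(𝔸)`
  and commutes in `Sp□(𝔸)` with `π(S̃ g)`, then Weil's `r_F(γ)` and the doubling lift `S̃(g) = r_F(δ)⁻¹ 𝐫₀(δ g^Δ δ⁻¹) r_F(δ)` COMMUTE ON THE NOSE
  in `Mp_ψ(𝕎□_𝔸)ᶜᵒⁿᵗ` (`𝐫₀ = r_F` at rational points of `P_𝕐(𝔸)` [Weil1964, n° 41 Thm 6], `𝐫₀` a homomorphism on `P_𝕐(𝔸)`).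
* §2 `coe_proj_doublingLift_toSp_adelicInl` — **`π(S̃(ι_e(h ⊗ 1))) = ι_{eD}(h ⊗ 1_{W⊕W⁻})`**: the plain `V`-diagonal doubling lift of the pair
  embedding of `h ∈ U(J_V)(𝔸)` projects onto the `V`-member of the DOUBLED pair (★ `adelicPairToSymplectic_adelicInl_finSum`: `h` acts
  diagonally on `(V ⊗ W) ⊕ (V ⊗ W)⁻`); `proj_doublingLift_toSp_adelicInl_mul_ratSp` — hence it COMMUTES in `Sp□(𝔸)` with `ratSp γ` for every
  `γ ∈ IW(F)`, i.e. every rational symplectic matrix whose base change is `ι_{eD}(1 ⊗ w)`, `w ∈ U(J_W ⊕ᶠ −J_W)(F)` (the two members of a dual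
  pair commute).

Written for the Hodge-CM cell `pub/hodgecm-mathlib`, floor 0, crux H413 (stmt-HodgeConjecture-24833), E-2 child line `F0_E2SiegelWeilWeilRange`,
stub `stub_SW2_siegelWeil`, row (INV) of F0P4-p07 (g2)'s assembly sheet `SW2c-BOUND-ASSEMBLY.v0` (theta half: invariance of the doubled theta
integral `I□` under `r_F(IW(F))` — the sequel file closes it from these two commutations); seat F0P4-p02 (g3), 2026-08-31.  HC_CM is proved only
modulo the printed citations until rung 0 closes; nothing here bears on a summit statement.

## References
* [Kudla1984] S. Kudla, *Seesaw dual reductive pairs*, Progr. Math. 46 (1984) 244–268, §1.* [GelbartPiatetskishapiroRallis1987] S. Gelbart, I. Piatetski-Shapiro, S. Rallis, LNM 1254 (1987), Part A §2 pp. 7–9 (`G^d = (G × G) ∩ P`).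
* [Li1992] J.-S. Li, J. reine angew. Math. 428 (1992) 177–217, §3 p. 181 (`δ`, the doubled pair).
* [Weil1964] A. Weil, *Sur certains groupes d'opérateurs unitaires*, Acta Math. 111 (1964), Chap. I n° 13 p. 160 (`𝐫₀`), Chap. III n° 40–41,
  Thm 6 p. 193 (`r_F`, Θ-rigidity).
-/

set_option autoImplicit false

noncomputable section

open scoped Kronecker Matrix
open NumberField
open Literature.RepresentationTheory.HeisenbergGroup
open Literature.NumberTheory.Weil1964

namespace Literature.NumberTheory.Automorphic

namespace UnitaryGroup

/-! ## §1 Reindexing combinatorics of the doubled enumeration -/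

section Reindex

variable {K : Type*} [CommRing K] {N n : ℕ} (e : Fin N × Fin 1 ≃ Fin n)

/-- the doubled enumeration `eD : Fin N × Fin (1+1) ≃ Fin (n + n)` of the E-2 child (`(i,0) ↦ inl (e (i,0))`, `(i,1) ↦ inr (e (i,0))`,
then `finSumFinEquiv`) factors as `finProdSumEquiv N 1 1` followed by `sumCongr e e` and `finSumFinEquiv`, pointwise. [folklore] -/
private theorem doubledEnum_apply (p : Fin N × Fin (1 + 1)) :
    ((((Equiv.prodCongr (Equiv.refl (Fin N)) finSumFinEquiv.symm).trans (Equiv.prodSumDistrib (Fin N) (Fin 1) (Fin 1))).trans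
        ((Equiv.sumCongr e e).trans finSumFinEquiv)) : Fin N × Fin (1 + 1) ≃ Fin (n + n)) p =
      finSumFinEquiv ((Equiv.sumCongr e e) (finProdSumEquiv N 1 1 p)) := by
  rfl

/-- **the `V`-diagonal reindexing identity**: for any automorphism `A` of `K^{N×1} × K^{N×1}`, reading `A ⊕ A` through
`(sumCongr e e ; finSumFinEquiv)` after `finProdSumEquiv` is the same as reading `(eAe⁻¹) ⊕ (eAe⁻¹)` through `finSumFinEquiv` — the coordinate form of
«`V ⊗ (W ⊕ W⁻) = (V ⊗ W) ⊕ (V ⊗ W)⁻`» on the `V`-member. [cite: Kudla1984, §1] -/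
theorem reindexW_spSumEquiv_doubled (A : ((Fin N × Fin 1 → K) × (Fin N × Fin 1 → K)) ≃ₗ[K] ((Fin N × Fin 1 → K) × (Fin N × Fin 1 → K)))
    (v : (Fin (n + n) → K) × (Fin (n + n) → K)) :
    reindexW K (finSumFinEquiv : Fin n ⊕ Fin n ≃ Fin (n + n))
        (spSumEquiv (((reindexW K e).symm.trans A).trans (reindexW K e)) (((reindexW K e).symm.trans A).trans (reindexW K e))
          ((reindexW K (finSumFinEquiv : Fin n ⊕ Fin n ≃ Fin (n + n))).symm v)) =
      reindexW K ((((Equiv.prodCongr (Equiv.refl (Fin N)) finSumFinEquiv.symm).trans (Equiv.prodSumDistrib (Fin N) (Fin 1) (Fin 1))).trans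
        ((Equiv.sumCongr e e).trans finSumFinEquiv)) : Fin N × Fin (1 + 1) ≃ Fin (n + n))
        ((reindexW K (finProdSumEquiv N 1 1)).symm
          (spSumEquiv A A (reindexW K (finProdSumEquiv N 1 1)
            ((reindexW K ((((Equiv.prodCongr (Equiv.refl (Fin N)) finSumFinEquiv.symm).trans
              (Equiv.prodSumDistrib (Fin N) (Fin 1) (Fin 1))).trans ((Equiv.sumCongr e e).trans finSumFinEquiv)) :
                Fin N × Fin (1 + 1) ≃ Fin (n + n))).symm v)))) := by
  set eD : Fin N × Fin (1 + 1) ≃ Fin (n + n) :=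
    (((Equiv.prodCongr (Equiv.refl (Fin N)) finSumFinEquiv.symm).trans (Equiv.prodSumDistrib (Fin N) (Fin 1) (Fin 1))).trans
      ((Equiv.sumCongr e e).trans finSumFinEquiv)) with heD
  have hD : ∀ p, eD p = finSumFinEquiv ((Equiv.sumCongr e e) (finProdSumEquiv N 1 1 p)) := fun p => rfl
  have h0 : ((finSumFinEquiv : Fin 1 ⊕ Fin 1 ≃ Fin (1 + 1)).symm 0 : Fin 1 ⊕ Fin 1) = Sum.inl 0 := by decide
  have h1 : ((finSumFinEquiv : Fin 1 ⊕ Fin 1 ≃ Fin (1 + 1)).symm 1 : Fin 1 ⊕ Fin 1) = Sum.inr 0 := by decide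
  have hP0 : ∀ i : Fin N, finProdSumEquiv N 1 1 (i, 0) = Sum.inl (i, 0) := fun i => by
    simp [finProdSumEquiv, h0]
  have hP1 : ∀ i : Fin N, finProdSumEquiv N 1 1 (i, 1) = Sum.inr (i, 0) := fun i => by
    simp [finProdSumEquiv, h1]
  have hS0 : ∀ i : Fin N, (finSumFinEquiv : Fin n ⊕ Fin n ≃ Fin (n + n)).symm (eD (i, 0)) = Sum.inl (e (i, 0)) := fun i => by
    rw [hD, Equiv.symm_apply_apply, hP0]; rfl
  have hS1 : ∀ i : Fin N, (finSumFinEquiv : Fin n ⊕ Fin n ≃ Fin (n + n)).symm (eD (i, 1)) = Sum.inr (e (i, 0)) := fun i => by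
    rw [hD, Equiv.symm_apply_apply, hP1]; rfl
  have hA0 : ∀ x : Fin N × Fin 1, eD ((finProdSumEquiv N 1 1).symm (Sum.inl x)) = finSumFinEquiv (Sum.inl (e x)) := fun x => by
    rw [hD, Equiv.apply_symm_apply]; rfl
  have hA1 : ∀ x : Fin N × Fin 1, eD ((finProdSumEquiv N 1 1).symm (Sum.inr x)) = finSumFinEquiv (Sum.inr (e x)) := fun x => by
    rw [hD, Equiv.apply_symm_apply]; rfl
  refine Prod.ext (funext fun m => ?_) (funext fun m => ?_) <;>
    obtain ⟨⟨i, k⟩, rfl⟩ := eD.surjective m <;>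
    simp only [reindexW_apply, Function.comp_apply, Equiv.symm_apply_apply] <;>
    fin_cases k <;>
    simp [hS0, hS1, hA0, hA1, hP0, hP1, reindexW_apply, reindexW_symm_apply, spSumEquiv_apply, Function.comp_def]

end Reindex

/-! ## §2a Generic: the doubling lift commutes ON THE NOSE with `r_F` at rational points of `δ⁻¹ P_𝕐 δ` that commute with it in `Sp□(𝔸)` -/

section DoublingGeneric

variable (F : Type) [Field F] [NumberField F] {n : ℕ} (T : Matrix (Fin n) (Fin n) (AdeleRing (𝓞 F) F)) (hT : IsUnit T.det)

/-- **EXACT commutation over the rational stabiliser `δ⁻¹ P_𝕐(F) δ`**: if `γ ∈ Sp_{2(n+n)}(F)` has `ratSp (δγδ⁻¹) ∈ P_𝕐(𝔸)` and commutes in `Sp□(𝔸)`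
with `π(S̃ g)`, then Weil's `r_F(γ) = r_F(δ)⁻¹ · 𝐫₀(ratSp (δγδ⁻¹)) · r_F(δ)` (`𝐫₀ = r_F` at rational points of `P_𝕐(𝔸)`, ★ `adelicSiegelLift_mem_adelicMpTheta_of_eq_ratSp`)
and the doubling lift `S̃(g) = r_F(δ)⁻¹ · 𝐫₀(δ g^Δ δ⁻¹) · r_F(δ)` COMMUTE ON THE NOSE in `Mp_ψ(𝕎□_𝔸)ᶜᵒⁿᵗ`: `𝐫₀` is a homomorphism on `P_𝕐(𝔸)` and the two
elements of `P_𝕐(𝔸)` commute. [cite: Weil1964, Chap. I n° 13 p. 160 and Chap. III n° 41 Thm 6 p. 193] [cite: GelbartPiatetskishapiroRallis1987, Part A §2 pp. 7–9] -/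
theorem doublingLift_mul_ratThetaLiftCont_of_mem_siegel (g : symplecticGroup (polar (Weil1964.adelicForm F (Fin n) T)))
    (γ : Matrix.symplecticGroup (Fin (n + n)) F)
    (hcomm : adelicMpCont.proj F (Fin (n + n)) (doubledGramFin F T) (doublingLift F T hT g) *
        ratSp F (doubledGramFin F T) (isUnit_det_doubledGramFin F T hT) γ =
      ratSp F (doubledGramFin F T) (isUnit_det_doubledGramFin F T hT) γ *
        adelicMpCont.proj F (Fin (n + n)) (doubledGramFin F T) (doublingLift F T hT g))
    (hP : ratSp F (doubledGramFin F T) (isUnit_det_doubledGramFin F T hT) (doublingDeltaRat F * γ * (doublingDeltaRat F)⁻¹) ∈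
      siegelParabolicPi (doubledGramFin F T)) :
    doublingLift F T hT g * ratThetaLiftCont F (doubledGramFin F T) (isUnit_det_doubledGramFin F T hT) γ =
      ratThetaLiftCont F (doubledGramFin F T) (isUnit_det_doubledGramFin F T hT) γ * doublingLift F T hT g := by
  -- `r_F(δγδ⁻¹) = 𝐫₀(ratSp (δγδ⁻¹))` (Θ-rigidity at a rational point of `P_𝕐(𝔸)`)
  have hrπ : ratThetaLiftCont F (doubledGramFin F T) (isUnit_det_doubledGramFin F T hT) (doublingDeltaRat F * γ * (doublingDeltaRat F)⁻¹) =
      adelicSiegelLiftCont F (doubledGramFin F T) (isUnit_det_doubledGramFin F T hT) ⟨_, hP⟩ :=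
    Subtype.ext (coe_ratThetaLiftCont_eq F (doubledGramFin F T) (isUnit_det_doubledGramFin F T hT)
      (adelicSiegelLift_mem_adelicMpTheta_of_eq_ratSp F (doubledGramFin F T) (isUnit_det_doubledGramFin F T hT) _ hP)
      (proj_adelicSiegelLift F (doubledGramFin F T) (isUnit_det_doubledGramFin F T hT) ⟨_, hP⟩))
  have hγ : γ = (doublingDeltaRat F)⁻¹ * (doublingDeltaRat F * γ * (doublingDeltaRat F)⁻¹) * doublingDeltaRat F := by group
  -- `r_F(γ) = r_F(δ)⁻¹ · 𝐫₀(ratSp (δγδ⁻¹)) · r_F(δ)` (term-mode bookkeeping: no `rw` across the big metaplectic terms)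
  have hconj : ∀ π : Matrix.symplecticGroup (Fin (n + n)) F,
      ratThetaLiftCont F (doubledGramFin F T) (isUnit_det_doubledGramFin F T hT) ((doublingDeltaRat F)⁻¹ * π * doublingDeltaRat F) =
        (ratThetaLiftCont F (doubledGramFin F T) (isUnit_det_doubledGramFin F T hT) (doublingDeltaRat F))⁻¹ *
          ratThetaLiftCont F (doubledGramFin F T) (isUnit_det_doubledGramFin F T hT) π *
            ratThetaLiftCont F (doubledGramFin F T) (isUnit_det_doubledGramFin F T hT) (doublingDeltaRat F) := fun π =>
    ((ratThetaLiftCont F (doubledGramFin F T) (isUnit_det_doubledGramFin F T hT)).map_mul _ _).trans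
      (congrArg (· * ratThetaLiftCont F (doubledGramFin F T) (isUnit_det_doubledGramFin F T hT) (doublingDeltaRat F))
        (((ratThetaLiftCont F (doubledGramFin F T) (isUnit_det_doubledGramFin F T hT)).map_mul _ _).trans
          (congrArg (· * ratThetaLiftCont F (doubledGramFin F T) (isUnit_det_doubledGramFin F T hT) π)
            ((ratThetaLiftCont F (doubledGramFin F T) (isUnit_det_doubledGramFin F T hT)).map_inv _))))
  have hrγ : ratThetaLiftCont F (doubledGramFin F T) (isUnit_det_doubledGramFin F T hT) γ =
      (doublingDeltaLift F T hT)⁻¹ * adelicSiegelLiftCont F (doubledGramFin F T) (isUnit_det_doubledGramFin F T hT) ⟨_, hP⟩ *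
        doublingDeltaLift F T hT :=
    ((congrArg (ratThetaLiftCont F (doubledGramFin F T) (isUnit_det_doubledGramFin F T hT)) hγ).trans (hconj _)).trans
      (congrArg (fun y => (ratThetaLiftCont F (doubledGramFin F T) (isUnit_det_doubledGramFin F T hT) (doublingDeltaRat F))⁻¹ * y *
        ratThetaLiftCont F (doubledGramFin F T) (isUnit_det_doubledGramFin F T hT) (doublingDeltaRat F)) hrπ)
  -- the two elements of `P_𝕐(𝔸)` commute (conjugate the `Sp□(𝔸)`-commutation by `δ`)
  have hD : ratSp F (doubledGramFin F T) (isUnit_det_doubledGramFin F T hT) (doublingDeltaRat F) =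
      spReindex finSumFinEquiv (Matrix.fromBlocks T 0 0 (-T)) (doublingDelta T hT) := ratSp_doublingDeltaRat F T hT
  have hX : adelicMpCont.proj F (Fin (n + n)) (doubledGramFin F T) (doublingLift F T hT g) =
      spReindex finSumFinEquiv (Matrix.fromBlocks T 0 0 (-T)) (spDiag T g) := proj_doublingLift F T hT g
  have eL : spReindex finSumFinEquiv (Matrix.fromBlocks T 0 0 (-T)) (doublingDelta T hT * spDiag T g * (doublingDelta T hT)⁻¹) =
      spReindex finSumFinEquiv (Matrix.fromBlocks T 0 0 (-T)) (doublingDelta T hT) *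
        adelicMpCont.proj F (Fin (n + n)) (doubledGramFin F T) (doublingLift F T hT g) *
        (spReindex finSumFinEquiv (Matrix.fromBlocks T 0 0 (-T)) (doublingDelta T hT))⁻¹ :=
    ((spReindex finSumFinEquiv (Matrix.fromBlocks T 0 0 (-T))).map_mul _ _).trans
      (congrArg₂ (· * ·) (((spReindex finSumFinEquiv (Matrix.fromBlocks T 0 0 (-T))).map_mul _ _).trans
        (congrArg (spReindex finSumFinEquiv (Matrix.fromBlocks T 0 0 (-T)) (doublingDelta T hT) * ·) hX.symm))
        ((spReindex finSumFinEquiv (Matrix.fromBlocks T 0 0 (-T))).map_inv _))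
  have eR : ratSp F (doubledGramFin F T) (isUnit_det_doubledGramFin F T hT) (doublingDeltaRat F * γ * (doublingDeltaRat F)⁻¹) =
      spReindex finSumFinEquiv (Matrix.fromBlocks T 0 0 (-T)) (doublingDelta T hT) *
        ratSp F (doubledGramFin F T) (isUnit_det_doubledGramFin F T hT) γ *
        (spReindex finSumFinEquiv (Matrix.fromBlocks T 0 0 (-T)) (doublingDelta T hT))⁻¹ :=
    ((ratSp F (doubledGramFin F T) (isUnit_det_doubledGramFin F T hT)).map_mul _ _).trans
      (congrArg₂ (· * ·) (((ratSp F (doubledGramFin F T) (isUnit_det_doubledGramFin F T hT)).map_mul _ _).trans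
        (congrArg (· * ratSp F (doubledGramFin F T) (isUnit_det_doubledGramFin F T hT) γ) hD))
        (((ratSp F (doubledGramFin F T) (isUnit_det_doubledGramFin F T hT)).map_inv _).trans (congrArg (·⁻¹) hD)))
  have hPP : doublingParabolicFin F T hT g * ⟨_, hP⟩ = ⟨_, hP⟩ * doublingParabolicFin F T hT g := by
    refine Subtype.ext ?_
    calc ((doublingParabolicFin F T hT g * ⟨_, hP⟩ : siegelParabolicPi (doubledGramFin F T)) :
            symplecticGroup (polar (Weil1964.adelicForm F (Fin (n + n)) (doubledGramFin F T))))
        = spReindex finSumFinEquiv (Matrix.fromBlocks T 0 0 (-T)) (doublingDelta T hT * spDiag T g * (doublingDelta T hT)⁻¹) *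
            ratSp F (doubledGramFin F T) (isUnit_det_doubledGramFin F T hT) (doublingDeltaRat F * γ * (doublingDeltaRat F)⁻¹) := rfl
      _ = spReindex finSumFinEquiv (Matrix.fromBlocks T 0 0 (-T)) (doublingDelta T hT) *
              adelicMpCont.proj F (Fin (n + n)) (doubledGramFin F T) (doublingLift F T hT g) *
              (spReindex finSumFinEquiv (Matrix.fromBlocks T 0 0 (-T)) (doublingDelta T hT))⁻¹ *
            (spReindex finSumFinEquiv (Matrix.fromBlocks T 0 0 (-T)) (doublingDelta T hT) *
              ratSp F (doubledGramFin F T) (isUnit_det_doubledGramFin F T hT) γ *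
              (spReindex finSumFinEquiv (Matrix.fromBlocks T 0 0 (-T)) (doublingDelta T hT))⁻¹) := congrArg₂ (· * ·) eL eR
      _ = spReindex finSumFinEquiv (Matrix.fromBlocks T 0 0 (-T)) (doublingDelta T hT) *
            (adelicMpCont.proj F (Fin (n + n)) (doubledGramFin F T) (doublingLift F T hT g) *
              ratSp F (doubledGramFin F T) (isUnit_det_doubledGramFin F T hT) γ) *
            (spReindex finSumFinEquiv (Matrix.fromBlocks T 0 0 (-T)) (doublingDelta T hT))⁻¹ := by group
      _ = spReindex finSumFinEquiv (Matrix.fromBlocks T 0 0 (-T)) (doublingDelta T hT) *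
            (ratSp F (doubledGramFin F T) (isUnit_det_doubledGramFin F T hT) γ *
              adelicMpCont.proj F (Fin (n + n)) (doubledGramFin F T) (doublingLift F T hT g)) *
            (spReindex finSumFinEquiv (Matrix.fromBlocks T 0 0 (-T)) (doublingDelta T hT))⁻¹ :=
          congrArg (fun z => spReindex finSumFinEquiv (Matrix.fromBlocks T 0 0 (-T)) (doublingDelta T hT) * z *
            (spReindex finSumFinEquiv (Matrix.fromBlocks T 0 0 (-T)) (doublingDelta T hT))⁻¹) hcomm
      _ = spReindex finSumFinEquiv (Matrix.fromBlocks T 0 0 (-T)) (doublingDelta T hT) *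
              ratSp F (doubledGramFin F T) (isUnit_det_doubledGramFin F T hT) γ *
              (spReindex finSumFinEquiv (Matrix.fromBlocks T 0 0 (-T)) (doublingDelta T hT))⁻¹ *
            (spReindex finSumFinEquiv (Matrix.fromBlocks T 0 0 (-T)) (doublingDelta T hT) *
              adelicMpCont.proj F (Fin (n + n)) (doubledGramFin F T) (doublingLift F T hT g) *
              (spReindex finSumFinEquiv (Matrix.fromBlocks T 0 0 (-T)) (doublingDelta T hT))⁻¹) := by group
      _ = ((⟨_, hP⟩ * doublingParabolicFin F T hT g : siegelParabolicPi (doubledGramFin F T)) :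
            symplecticGroup (polar (Weil1964.adelicForm F (Fin (n + n)) (doubledGramFin F T)))) := (congrArg₂ (· * ·) eR eL).symm
  -- `𝐫₀` is a homomorphism on `P_𝕐(𝔸)`
  calc doublingLift F T hT g * ratThetaLiftCont F (doubledGramFin F T) (isUnit_det_doubledGramFin F T hT) γ
      = (doublingDeltaLift F T hT)⁻¹ * adelicSiegelLiftCont F (doubledGramFin F T) (isUnit_det_doubledGramFin F T hT) (doublingParabolicFin F T hT g) *
          doublingDeltaLift F T hT *
        ((doublingDeltaLift F T hT)⁻¹ * adelicSiegelLiftCont F (doubledGramFin F T) (isUnit_det_doubledGramFin F T hT) ⟨_, hP⟩ *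
          doublingDeltaLift F T hT) := congrArg₂ (· * ·) (doublingLift_apply F T hT g) hrγ
    _ = (doublingDeltaLift F T hT)⁻¹ * (adelicSiegelLiftCont F (doubledGramFin F T) (isUnit_det_doubledGramFin F T hT) (doublingParabolicFin F T hT g) *
          adelicSiegelLiftCont F (doubledGramFin F T) (isUnit_det_doubledGramFin F T hT) ⟨_, hP⟩) * doublingDeltaLift F T hT := by group
    _ = (doublingDeltaLift F T hT)⁻¹ * (adelicSiegelLiftCont F (doubledGramFin F T) (isUnit_det_doubledGramFin F T hT)
          (doublingParabolicFin F T hT g * ⟨_, hP⟩)) * doublingDeltaLift F T hT :=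
          congrArg (fun z => (doublingDeltaLift F T hT)⁻¹ * z * doublingDeltaLift F T hT)
            ((adelicSiegelLiftCont F (doubledGramFin F T) (isUnit_det_doubledGramFin F T hT)).map_mul _ _).symm
    _ = (doublingDeltaLift F T hT)⁻¹ * (adelicSiegelLiftCont F (doubledGramFin F T) (isUnit_det_doubledGramFin F T hT)
          (⟨_, hP⟩ * doublingParabolicFin F T hT g)) * doublingDeltaLift F T hT :=
          congrArg (fun z => (doublingDeltaLift F T hT)⁻¹ *
            adelicSiegelLiftCont F (doubledGramFin F T) (isUnit_det_doubledGramFin F T hT) z * doublingDeltaLift F T hT) hPP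
    _ = (doublingDeltaLift F T hT)⁻¹ * (adelicSiegelLiftCont F (doubledGramFin F T) (isUnit_det_doubledGramFin F T hT) ⟨_, hP⟩ *
          adelicSiegelLiftCont F (doubledGramFin F T) (isUnit_det_doubledGramFin F T hT) (doublingParabolicFin F T hT g)) *
            doublingDeltaLift F T hT :=
          congrArg (fun z => (doublingDeltaLift F T hT)⁻¹ * z * doublingDeltaLift F T hT)
            ((adelicSiegelLiftCont F (doubledGramFin F T) (isUnit_det_doubledGramFin F T hT)).map_mul _ _)
    _ = (doublingDeltaLift F T hT)⁻¹ * adelicSiegelLiftCont F (doubledGramFin F T) (isUnit_det_doubledGramFin F T hT) ⟨_, hP⟩ *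
          doublingDeltaLift F T hT *
        ((doublingDeltaLift F T hT)⁻¹ * adelicSiegelLiftCont F (doubledGramFin F T) (isUnit_det_doubledGramFin F T hT) (doublingParabolicFin F T hT g) *
          doublingDeltaLift F T hT) := by group
    _ = ratThetaLiftCont F (doubledGramFin F T) (isUnit_det_doubledGramFin F T hT) γ * doublingLift F T hT g :=
          (congrArg₂ (· * ·) hrγ (doublingLift_apply F T hT g)).symm

end DoublingGeneric

/-! ## §2 The plain `V`-diagonal doubling lift projects to the `V`-member of the DOUBLED pair -/

section DoubledPair

variable (F E : Type) [Field F] [NumberField F] [Field E] [NumberField E] [Algebra F E] [Algebra.IsQuadraticExtension F E]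
  (c : E ≃ₐ[F] E) {δ : E} (hcδ : c δ = -δ) (hδ : δ ≠ 0) {d : F} (hd : δ * δ = algebraMap F E d)
  (N : ℕ) {n : ℕ} (e : Fin N × Fin 1 ≃ Fin n)
  {TV : Matrix (Fin N) (Fin N) F} {TW : Matrix (Fin 1) (Fin 1) F} {TW2 : Matrix (Fin (1 + 1)) (Fin (1 + 1)) F}
  (hV : TV.IsSymm) (hW : TW.IsSymm) (hW2 : TW2.IsSymm) (hVd : IsUnit TV.det) (hWd : IsUnit TW.det)
  (hTW2 : TW2 = finSum 1 1 TW (-TW))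

/-- bridge (private plumbing): the pair embedding of `g ⊗ 1` read as an automorphism of `𝕎_𝔸` does not depend on the SPELLING of the
hermitian matrix `J_W = T_W ⊗ 1` of the second member. [folklore] -/
private theorem coe_adelicPairToSymplectic_adelicInl_eq_of_eq {M : ℕ} {TW' : Matrix (Fin M) (Fin M) F} (hW' hW'' : TW'.IsSymm)
    {JW JW' : Matrix (Fin M) (Fin M) E} (hJW : JW = TW'.map (algebraMap F E)) (hJW' : JW' = TW'.map (algebraMap F E))
    (g : adelic F E c N (TV.map (algebraMap F E))) :
    ((adelicPairToSymplectic F E c N M hcδ hδ hd hV hW' rfl hJW (adelicInl F E c N M (TV.map (algebraMap F E)) JW g) :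
        symplecticGroup (polar (Matrix.toLinearMap₂' (AdeleRing (𝓞 F) F)
          ((TV.map (algebraMap F (AdeleRing (𝓞 F) F))) ⊗ₖ (TW'.map (algebraMap F (AdeleRing (𝓞 F) F))))))) :
        ((Fin N × Fin M → AdeleRing (𝓞 F) F) × (Fin N × Fin M → AdeleRing (𝓞 F) F)) ≃ₗ[AdeleRing (𝓞 F) F]
          ((Fin N × Fin M → AdeleRing (𝓞 F) F) × (Fin N × Fin M → AdeleRing (𝓞 F) F))) =
      ((adelicPairToSymplectic F E c N M hcδ hδ hd hV hW'' rfl hJW' (adelicInl F E c N M (TV.map (algebraMap F E)) JW' g) :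
        symplecticGroup (polar (Matrix.toLinearMap₂' (AdeleRing (𝓞 F) F)
          ((TV.map (algebraMap F (AdeleRing (𝓞 F) F))) ⊗ₖ (TW'.map (algebraMap F (AdeleRing (𝓞 F) F))))))) :
        ((Fin N × Fin M → AdeleRing (𝓞 F) F) × (Fin N × Fin M → AdeleRing (𝓞 F) F)) ≃ₗ[AdeleRing (𝓞 F) F]
          ((Fin N × Fin M → AdeleRing (𝓞 F) F) × (Fin N × Fin M → AdeleRing (𝓞 F) F))) := by
  subst hJW; subst hJW'; rfl

set_option maxHeartbeats 400000 in
include hTW2 in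
/-- **`π(S̃(ι_e(h ⊗ 1))) = ι_{eD}(h ⊗ 1_{W□})`** — the plain `V`-diagonal doubling lift `S̃ ∘ ι_e ∘ a` (`doublingLift` of the pair embedding of
`h ⊗ 1_W`) projects, as an automorphism of `𝕎□_𝔸 = 𝔸_F^{n+n} × 𝔸_F^{n+n}`, onto the pair embedding of `h ⊗ 1_{W ⊕ W⁻}` for the DOUBLED pair
`(U(J_V), U(J_W ⊕ᶠ −J_W))` in the doubled enumeration `eD : (i,0) ↦ inl (e(i,0)), (i,1) ↦ inr (e(i,0))` — «`G^d = (G × G) ∩ P`» read on the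
`V`-member: `h` acts diagonally on `(V ⊗ W) ⊕ (V ⊗ W)⁻`. [cite: GelbartPiatetskishapiroRallis1987, Part A §2 pp. 7–9] [cite: Kudla1984, §1] -/
theorem coe_proj_doublingLift_toSp_adelicInl (h : adelic F E c N (TV.map (algebraMap F E))) :
    ((adelicMpCont.proj F (Fin (n + n)) (doubledGramFin F (GelbartRogawski1991.UnitaryDualPair.adelicGram F e TV TW))
        (doublingLift F (GelbartRogawski1991.UnitaryDualPair.adelicGram F e TV TW)
          (GelbartRogawski1991.UnitaryDualPair.isUnit_det_adelicGram F e hVd hWd)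
          (GelbartRogawski1991.UnitaryDualPair.toSp F E c N 1 e (TV.map (algebraMap F E)) (TW.map (algebraMap F E)) hcδ hδ hd hV hW rfl rfl
            (adelicInl F E c N 1 (TV.map (algebraMap F E)) (TW.map (algebraMap F E)) h))) :
        symplecticGroup (polar (Weil1964.adelicForm F (Fin (n + n))
          (doubledGramFin F (GelbartRogawski1991.UnitaryDualPair.adelicGram F e TV TW))))) :
        ((Fin (n + n) → AdeleRing (𝓞 F) F) × (Fin (n + n) → AdeleRing (𝓞 F) F)) ≃ₗ[AdeleRing (𝓞 F) F]
          ((Fin (n + n) → AdeleRing (𝓞 F) F) × (Fin (n + n) → AdeleRing (𝓞 F) F))) =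
      ((GelbartRogawski1991.UnitaryDualPair.toSp F E c N (1 + 1)
          (((Equiv.prodCongr (Equiv.refl (Fin N)) finSumFinEquiv.symm).trans (Equiv.prodSumDistrib (Fin N) (Fin 1) (Fin 1))).trans
            ((Equiv.sumCongr e e).trans finSumFinEquiv))
          (TV.map (algebraMap F E)) (TW2.map (algebraMap F E)) hcδ hδ hd hV hW2 rfl rfl
          (adelicInl F E c N (1 + 1) (TV.map (algebraMap F E)) (TW2.map (algebraMap F E)) h) :
          symplecticGroup (polar (Weil1964.adelicForm F (Fin (n + n))
            (GelbartRogawski1991.UnitaryDualPair.adelicGram F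
              (((Equiv.prodCongr (Equiv.refl (Fin N)) finSumFinEquiv.symm).trans (Equiv.prodSumDistrib (Fin N) (Fin 1) (Fin 1))).trans
                ((Equiv.sumCongr e e).trans finSumFinEquiv)) TV TW2)))) :
        ((Fin (n + n) → AdeleRing (𝓞 F) F) × (Fin (n + n) → AdeleRing (𝓞 F) F)) ≃ₗ[AdeleRing (𝓞 F) F]
          ((Fin (n + n) → AdeleRing (𝓞 F) F) × (Fin (n + n) → AdeleRing (𝓞 F) F))) := by
  subst hTW2
  rw [proj_doublingLift]
  refine LinearEquiv.ext fun v => ?_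
  refine (reindexW_spSumEquiv_doubled (K := AdeleRing (𝓞 F) F) e
    ((adelicPairToSymplectic F E c N 1 hcδ hδ hd hV hW rfl rfl
        (adelicInl F E c N 1 (TV.map (algebraMap F E)) (TW.map (algebraMap F E)) h) :
          symplecticGroup (polar (Matrix.toLinearMap₂' (AdeleRing (𝓞 F) F)
            ((TV.map (algebraMap F (AdeleRing (𝓞 F) F))) ⊗ₖ (TW.map (algebraMap F (AdeleRing (𝓞 F) F))))))) :
        ((Fin N × Fin 1 → AdeleRing (𝓞 F) F) × (Fin N × Fin 1 → AdeleRing (𝓞 F) F)) ≃ₗ[AdeleRing (𝓞 F) F]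
          ((Fin N × Fin 1 → AdeleRing (𝓞 F) F) × (Fin N × Fin 1 → AdeleRing (𝓞 F) F))) v).trans ?_
  rw [GelbartRogawski1991.UnitaryDualPair.toSp_apply, coe_spReindex_apply]
  congr 1
  -- the `W□`-member with its hermitian matrix spelled `(T_W ⊕ᶠ −T_W) ⊗ 1` vs `(T_W ⊗ 1) ⊕ᶠ (−T_W ⊗ 1)`
  rw [coe_adelicPairToSymplectic_adelicInl_eq_of_eq F E c hcδ hδ hd N hV (M := 1 + 1) hW2 (isSymm_finSum hW hW.neg)
    (JW := (finSum 1 1 TW (-TW)).map (algebraMap F E)) (JW' := finSum 1 1 (TW.map (algebraMap F E)) ((-TW).map (algebraMap F E)))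
    rfl (by rw [finSum_map]) h]
  have key := adelicPairToSymplectic_adelicInl_finSum F E c N 1 1 hcδ hδ hd hV hW hW.neg
    (rfl : TV.map (algebraMap F E) = TV.map (algebraMap F E)) (rfl : TW.map (algebraMap F E) = TW.map (algebraMap F E))
    (rfl : (-TW).map (algebraMap F E) = (-TW).map (algebraMap F E)) h
  have hkey := LinearEquiv.congr_fun key
    (reindexW (AdeleRing (𝓞 F) F) (finProdSumEquiv N 1 1)
      ((reindexW (AdeleRing (𝓞 F) F)
        ((((Equiv.prodCongr (Equiv.refl (Fin N)) finSumFinEquiv.symm).trans (Equiv.prodSumDistrib (Fin N) (Fin 1) (Fin 1))).trans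
          ((Equiv.sumCongr e e).trans finSumFinEquiv)) : Fin N × Fin (1 + 1) ≃ Fin (n + n))).symm v))
  rw [coe_spReindex_apply, LinearEquiv.symm_apply_apply, coe_spSum] at hkey
  -- the `W⁻`-factor: `ι_{V,W⁻}(h ⊗ 1) = ι_{V,W}(h ⊗ 1)` as automorphisms (the hermitian form plays no role in `Res(h ⊗ 1)`)
  have hA : ((adelicPairToSymplectic F E c N 1 hcδ hδ hd hV hW.neg rfl rfl
        (adelicInl F E c N 1 (TV.map (algebraMap F E)) ((-TW).map (algebraMap F E)) h) :
          symplecticGroup (polar (Matrix.toLinearMap₂' (AdeleRing (𝓞 F) F)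
            ((TV.map (algebraMap F (AdeleRing (𝓞 F) F))) ⊗ₖ ((-TW).map (algebraMap F (AdeleRing (𝓞 F) F))))))) :
        ((Fin N × Fin 1 → AdeleRing (𝓞 F) F) × (Fin N × Fin 1 → AdeleRing (𝓞 F) F)) ≃ₗ[AdeleRing (𝓞 F) F]
          ((Fin N × Fin 1 → AdeleRing (𝓞 F) F) × (Fin N × Fin 1 → AdeleRing (𝓞 F) F))) =
      ((adelicPairToSymplectic F E c N 1 hcδ hδ hd hV hW rfl rfl
        (adelicInl F E c N 1 (TV.map (algebraMap F E)) (TW.map (algebraMap F E)) h) :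
          symplecticGroup (polar (Matrix.toLinearMap₂' (AdeleRing (𝓞 F) F)
            ((TV.map (algebraMap F (AdeleRing (𝓞 F) F))) ⊗ₖ (TW.map (algebraMap F (AdeleRing (𝓞 F) F))))))) :
        ((Fin N × Fin 1 → AdeleRing (𝓞 F) F) × (Fin N × Fin 1 → AdeleRing (𝓞 F) F)) ≃ₗ[AdeleRing (𝓞 F) F]
          ((Fin N × Fin 1 → AdeleRing (𝓞 F) F) × (Fin N × Fin 1 → AdeleRing (𝓞 F) F))) := by
    have hxy : ((adelicInl F E c N 1 (TV.map (algebraMap F E)) ((-TW).map (algebraMap F E)) h :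
          adelicPair F E c N 1 (TV.map (algebraMap F E)) ((-TW).map (algebraMap F E))) : GL (Fin N × Fin 1) (AdeleRing (𝓞 E) E)) =
        ((adelicInl F E c N 1 (TV.map (algebraMap F E)) (TW.map (algebraMap F E)) h :
          adelicPair F E c N 1 (TV.map (algebraMap F E)) (TW.map (algebraMap F E))) : GL (Fin N × Fin 1) (AdeleRing (𝓞 E) E)) :=
      Units.ext (by rw [coe_adelicInl, coe_adelicInl])
    change (isQuadraticCoordinates_adele E c hcδ hδ hd).resAut (Fin N × Fin 1)
        ((adelicInl F E c N 1 (TV.map (algebraMap F E)) ((-TW).map (algebraMap F E)) h :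
          adelicPair F E c N 1 (TV.map (algebraMap F E)) ((-TW).map (algebraMap F E))) : GL (Fin N × Fin 1) (AdeleRing (𝓞 E) E)) =
      (isQuadraticCoordinates_adele E c hcδ hδ hd).resAut (Fin N × Fin 1)
        ((adelicInl F E c N 1 (TV.map (algebraMap F E)) (TW.map (algebraMap F E)) h :
          adelicPair F E c N 1 (TV.map (algebraMap F E)) (TW.map (algebraMap F E))) : GL (Fin N × Fin 1) (AdeleRing (𝓞 E) E))
    rw [hxy]
  rw [LinearEquiv.symm_apply_eq, hkey]
  exact congrArg (fun B => spSumEquiv _ B _) hA.symm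


include hTW2 in
/-- **the `V`-diagonal doubling lift commutes, in `Sp□(𝔸)`, with the rational points of the doubled `W`-member** — for `γ ∈ IW` (i.e. `ratSp γ = ι_{eD}(1 ⊗ w)`
for a rational `w ∈ U(J_W ⊕ᶠ −J_W)(F)`): `π(S̃(ι(h ⊗ 1))) · ratSp γ = ratSp γ · π(S̃(ι(h ⊗ 1)))` (the two members of the doubled dual pair commute).
[cite: Kudla1984, §1] [cite: GelbartPiatetskishapiroRallis1987, Part A §2 pp. 7–9] -/
theorem proj_doublingLift_toSp_adelicInl_mul_ratSp (h : adelic F E c N (TV.map (algebraMap F E)))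
    (γ : Matrix.symplecticGroup (Fin (n + n)) F) (w : rational F E c (1 + 1) (TW2.map (algebraMap F E)))
    (hγw : ((GelbartRogawski1991.UnitaryDualPair.toSp F E c N (1 + 1)
          (((Equiv.prodCongr (Equiv.refl (Fin N)) finSumFinEquiv.symm).trans (Equiv.prodSumDistrib (Fin N) (Fin 1) (Fin 1))).trans
            ((Equiv.sumCongr e e).trans finSumFinEquiv))
          (TV.map (algebraMap F E)) (TW2.map (algebraMap F E)) hcδ hδ hd hV hW2 rfl rfl
          (adelicInr F E c N (1 + 1) (TV.map (algebraMap F E)) (TW2.map (algebraMap F E)) (toAdelic F E c (1 + 1) (TW2.map (algebraMap F E)) w)) :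
          symplecticGroup (polar (Weil1964.adelicForm F (Fin (n + n))
            (GelbartRogawski1991.UnitaryDualPair.adelicGram F
              (((Equiv.prodCongr (Equiv.refl (Fin N)) finSumFinEquiv.symm).trans (Equiv.prodSumDistrib (Fin N) (Fin 1) (Fin 1))).trans
                ((Equiv.sumCongr e e).trans finSumFinEquiv)) TV TW2)))) :
        ((Fin (n + n) → AdeleRing (𝓞 F) F) × (Fin (n + n) → AdeleRing (𝓞 F) F)) ≃ₗ[AdeleRing (𝓞 F) F]
          ((Fin (n + n) → AdeleRing (𝓞 F) F) × (Fin (n + n) → AdeleRing (𝓞 F) F))) =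
      ((ratSp F (doubledGramFin F (GelbartRogawski1991.UnitaryDualPair.adelicGram F e TV TW))
          (isUnit_det_doubledGramFin F _ (GelbartRogawski1991.UnitaryDualPair.isUnit_det_adelicGram F e hVd hWd)) γ :
          symplecticGroup (polar (Weil1964.adelicForm F (Fin (n + n))
            (doubledGramFin F (GelbartRogawski1991.UnitaryDualPair.adelicGram F e TV TW))))) :
        ((Fin (n + n) → AdeleRing (𝓞 F) F) × (Fin (n + n) → AdeleRing (𝓞 F) F)) ≃ₗ[AdeleRing (𝓞 F) F]
          ((Fin (n + n) → AdeleRing (𝓞 F) F) × (Fin (n + n) → AdeleRing (𝓞 F) F)))) :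
    adelicMpCont.proj F (Fin (n + n)) (doubledGramFin F (GelbartRogawski1991.UnitaryDualPair.adelicGram F e TV TW))
        (doublingLift F (GelbartRogawski1991.UnitaryDualPair.adelicGram F e TV TW)
          (GelbartRogawski1991.UnitaryDualPair.isUnit_det_adelicGram F e hVd hWd)
          (GelbartRogawski1991.UnitaryDualPair.toSp F E c N 1 e (TV.map (algebraMap F E)) (TW.map (algebraMap F E)) hcδ hδ hd hV hW rfl rfl
            (adelicInl F E c N 1 (TV.map (algebraMap F E)) (TW.map (algebraMap F E)) h))) *
      ratSp F (doubledGramFin F (GelbartRogawski1991.UnitaryDualPair.adelicGram F e TV TW))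
        (isUnit_det_doubledGramFin F _ (GelbartRogawski1991.UnitaryDualPair.isUnit_det_adelicGram F e hVd hWd)) γ =
    ratSp F (doubledGramFin F (GelbartRogawski1991.UnitaryDualPair.adelicGram F e TV TW))
        (isUnit_det_doubledGramFin F _ (GelbartRogawski1991.UnitaryDualPair.isUnit_det_adelicGram F e hVd hWd)) γ *
      adelicMpCont.proj F (Fin (n + n)) (doubledGramFin F (GelbartRogawski1991.UnitaryDualPair.adelicGram F e TV TW))
        (doublingLift F (GelbartRogawski1991.UnitaryDualPair.adelicGram F e TV TW)
          (GelbartRogawski1991.UnitaryDualPair.isUnit_det_adelicGram F e hVd hWd)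
          (GelbartRogawski1991.UnitaryDualPair.toSp F E c N 1 e (TV.map (algebraMap F E)) (TW.map (algebraMap F E)) hcδ hδ hd hV hW rfl rfl
            (adelicInl F E c N 1 (TV.map (algebraMap F E)) (TW.map (algebraMap F E)) h))) := by
  have hX := coe_proj_doublingLift_toSp_adelicInl F E c hcδ hδ hd N e hV hW hW2 hVd hWd hTW2 h
  have hc := (commute_adelicInl_adelicInr F E c N (1 + 1) (TV.map (algebraMap F E)) (TW2.map (algebraMap F E)) h
    (toAdelic F E c (1 + 1) (TW2.map (algebraMap F E)) w)).map
    (GelbartRogawski1991.UnitaryDualPair.toSp F E c N (1 + 1)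
      (((Equiv.prodCongr (Equiv.refl (Fin N)) finSumFinEquiv.symm).trans (Equiv.prodSumDistrib (Fin N) (Fin 1) (Fin 1))).trans
        ((Equiv.sumCongr e e).trans finSumFinEquiv))
      (TV.map (algebraMap F E)) (TW2.map (algebraMap F E)) hcδ hδ hd hV hW2 rfl rfl)
  have hc' := congrArg (fun g => ((g : symplecticGroup (polar (Weil1964.adelicForm F (Fin (n + n))
      (GelbartRogawski1991.UnitaryDualPair.adelicGram F
        (((Equiv.prodCongr (Equiv.refl (Fin N)) finSumFinEquiv.symm).trans (Equiv.prodSumDistrib (Fin N) (Fin 1) (Fin 1))).trans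
          ((Equiv.sumCongr e e).trans finSumFinEquiv)) TV TW2)))) :
    ((Fin (n + n) → AdeleRing (𝓞 F) F) × (Fin (n + n) → AdeleRing (𝓞 F) F)) ≃ₗ[AdeleRing (𝓞 F) F]
      ((Fin (n + n) → AdeleRing (𝓞 F) F) × (Fin (n + n) → AdeleRing (𝓞 F) F)))) hc.eq
  simp only [Subgroup.coe_mul] at hc'
  exact Subtype.ext ((Subgroup.coe_mul _ _ _).trans ((((congrArg₂ (· * ·) hX hγw.symm).trans hc').trans
    (congrArg₂ (· * ·) hγw hX.symm)).trans (Subgroup.coe_mul _ _ _).symm))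

end DoubledPair

end UnitaryGroup

end Literature.NumberTheory.Automorphic
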